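import Literature.IUT.HodgeArakelov.KummerPrimeStripsNonVacuity

/-!
# [IUTchII] Definition 4.9 (i): non-vacuity of `×`-Kummer and `×μ`-Kummer Frobenioids (theorem-only)

S. Mochizuki, *Inter-universal Teichmüller theory II: Hodge–Arakelov-theoretic evaluation*, §4,
Definition 4.9 (i) (kurims Dec-2020 manuscript pp. 154–155): "any Frobenioid equipped with a
`×`-Kummer structure [resp. `×μ`-Kummer structure] will be referred to as a `×`-Kummer [resp.
`×μ`-Kummer] Frobenioid". [cite: Mochizuki2012, Def 4.9 (i) p.155]. Claim key DISPUTED (D-0012): nothing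
here asserts a disputed claim or takes a side on [IUTchIII] Cor 3.12.

PROOF-ONLY companion (abc-iut cell, layer L6, node **IUTchII:Def4.9(i)**; row family «NV-L6»,
names `KummerTimesFrobenioid` / `KummerTimesMuFrobenioid` of abc-iut-w5-d114's inhabitation census v3,
which records ZERO producers for both records of abc-iut-L6-t2's statement file
`KummerStructures.lean`). NO definitions, instances or structures are declared: every witness is built
inside a theorem.

**What is shown.**
* `nonempty_kummerTimes_of_equivariantIso` / `nonempty_kummerTimesMu_of_equivariantIso`: for ANY
  group-theoretic units `X = (G ↷ O^×(G), Im(Ẑ^×))` and ANY covering monoid `G ↷ O^▷(A)`, every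
  `G`-equivariant isomorphism `κ : O^×(G) ⥲ O^×(A)` generates a `×`-Kummer structure (its
  `Im(Ẑ^×)`-orbit `{κ ∘ γ}`) and a `×μ`-Kummer structure (the `Ism`-orbit of the isomorphism
  `O^{×μ}(G) ⥲ O^{×μ}(A)` induced by `κ` on the quotients by torsion) — exactly the recipe of
  Def 4.9 (i) ("a `Ẑ^×`-orbit of isomorphisms", "an `Ism`-orbit of isomorphisms"); hence
  (`KummerTimesFrobenioid.nonempty_of_equivariantIso`, `KummerTimesMuFrobenioid.…`) a `×`-Kummer and
  a `×μ`-Kummer Frobenioid.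
* `KummerTimesFrobenioid.nonempty_model` / `KummerTimesMuFrobenioid.nonempty_model`: for EVERY group
  `G` and EVERY `X`, both records are inhabited by the STANDARD SPLIT MODEL `O^▷(A) := O^×(G) × ϖ^ℕ`
  (units `O^×(G)`, one free non-unit generator `ϖ` — the shape of `O^▷_{k_v} = O^×_{k_v} × ϖ_v^ℕ`), with
  `G` acting through `X` on the units and trivially on `ϖ`, and the TAUTOLOGICAL identification
  `κ : O^×(G) ⥲ (O^×(G) × ϖ^ℕ)^×`. HONEST LABEL: genuine in shape and valid at every parameter `X`
  (in particular at the genuine `X` = [AbsTopIII] Cor 1.10's output, once a producer for it lands);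
  the anabelian content (that `κ` is THE Kummer isomorphism, uniqueness of the orbit — Remark
  1.11.1 (b), the named statement `KummerTimesUnique`) is not modelled here.
* `KummerTimesFrobenioid.nonempty_model_dvr` / `KummerTimesMuFrobenioid.nonempty_model_dvr`: the
  model `O^▷ := R ∖ {0}` of a discrete valuation ring `R` (e.g. `𝒪_{K_v}`) of abc-iut-L6-d7's
  `nonempty_nonarchTriMuDatum'` (consumed BY NAME, through abc-iut-L6-t2's producers
  `NonarchTriMuDatum.splitKummerTimes` / `splitKummerTimesMu`).
* the bookkeeping equivalences `KummerTimesFrobenioid.nonempty_iff` (a `×`-Kummer Frobenioid over `X`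
  exists iff some covering monoid carries a `×`-Kummer structure) and the passages from the split
  records and from `NonarchTriMuDatum`.
-/

namespace Literature.IUT.HodgeArakelov

open scoped nonZeroDivisors

universe u v w

variable {G : Type u} [Group G]

/-! ### 1. Any equivariant isomorphism generates a `×`- and a `×μ`-Kummer structure -/

/-- **IUTchII:Def4.9(i)** (kurims p.154) For any group-theoretic units `X` and covering monoid `M`,
the `Im(Ẑ^×)`-orbit `{κ ∘ γ | γ ∈ Im(Ẑ^×)}` of a `G`-equivariant isomorphism
`κ : O^×(G) ⥲ O^×(A)` is a `×`-Kummer structure ("a `Ẑ^×`-orbit of isomorphisms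
`κ^× : O^×(G) ⥲ O^×(A)` of ind-topological `G`-modules"). [cite: Mochizuki2012, Def 4.9 (i) p.154] -/
theorem nonempty_kummerTimes_of_equivariantIso (X : GroupTheoreticUnits.{u, v} G)
    (M : CoveringMonoid.{u, w} G) (κ : EquivariantIso X.act M.unitsAct) :
    Nonempty (KummerTimes X M) :=
  ⟨⟨{κ' | ∃ γ ∈ X.zhatUnits, κ'.toMulEquiv = γ.trans κ.toMulEquiv},
    ⟨κ, ⟨1, X.zhatUnits.one_mem, MulEquiv.ext fun _ => rfl⟩, fun _ => Iff.rfl⟩⟩⟩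

/-- **IUTchII:Def4.9(i)** (kurims p.154) For any group-theoretic units `X` and covering monoid `M`, a
`G`-equivariant isomorphism `κ : O^×(G) ⥲ O^×(A)` induces a `G`-equivariant isomorphism
`O^{×μ}(G) ⥲ O^{×μ}(A)` of the quotients by torsion, whose `Ism(G)`-orbit is a `×μ`-Kummer structure
("an `Ism`-orbit of isomorphisms `κ^{×μ} : O^{×μ}(G) ⥲ O^{×μ}(A)`"). [cite: Mochizuki2012, Def 4.9 (i) p.154] -/
theorem nonempty_kummerTimesMu_of_equivariantIso (X : GroupTheoreticUnits.{u, v} G)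
    (M : CoveringMonoid.{u, w} G) (κ : EquivariantIso X.act M.unitsAct) :
    Nonempty (KummerTimesMu X M) := by
  let κμ : EquivariantIso (actionModTorsion X.act) M.unitsModTorsionAct :=
    ⟨MulEquivModTorsion κ.toMulEquiv, fun g x => by
      induction x using QuotientGroup.induction_on with
      | H z =>
        simp only [CoveringMonoid.unitsModTorsionAct, actionModTorsion_mk, mulEquivModTorsion_mk,
          κ.map_act]⟩
  exact ⟨⟨{κ' | ∃ γ ∈ isometryGroup X.act X.openSubgroups, κ'.toMulEquiv = γ.trans κμ.toMulEquiv},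
    ⟨κμ, ⟨1, Subgroup.one_mem _, MulEquiv.ext fun _ => rfl⟩, fun _ => Iff.rfl⟩⟩⟩

/-- **IUTchII:Def4.9(i)** (kurims p.155) Hence any `G`-equivariant isomorphism `κ : O^×(G) ⥲ O^×(A)` makes
`G ↷ O^▷(A)` a `×`-Kummer Frobenioid. [cite: Mochizuki2012, Def 4.9 (i) p.155] -/
theorem KummerTimesFrobenioid.nonempty_of_equivariantIso (X : GroupTheoreticUnits.{u, v} G)
    (M : CoveringMonoid.{u, w} G) (κ : EquivariantIso X.act M.unitsAct) :
    Nonempty (KummerTimesFrobenioid.{u, v, w} X) := by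
  obtain ⟨κT⟩ := nonempty_kummerTimes_of_equivariantIso X M κ
  exact ⟨⟨M, κT⟩⟩

/-- **IUTchII:Def4.9(i)** (kurims p.155) … and a `×μ`-Kummer Frobenioid.
[cite: Mochizuki2012, Def 4.9 (i) p.155] -/
theorem KummerTimesMuFrobenioid.nonempty_of_equivariantIso (X : GroupTheoreticUnits.{u, v} G)
    (M : CoveringMonoid.{u, w} G) (κ : EquivariantIso X.act M.unitsAct) :
    Nonempty (KummerTimesMuFrobenioid.{u, v, w} X) := by
  obtain ⟨κM⟩ := nonempty_kummerTimesMu_of_equivariantIso X M κ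
  exact ⟨⟨M, κM⟩⟩

/-! ### 2. Bookkeeping: the records versus their components -/

/-- **IUTchII:Def4.9(i)** (kurims p.155) A `×`-Kummer Frobenioid over `X` exists iff some covering monoid
carries a `×`-Kummer structure relative to `X`. [cite: Mochizuki2012, Def 4.9 (i) p.155] -/
theorem KummerTimesFrobenioid.nonempty_iff (X : GroupTheoreticUnits.{u, v} G) :
    Nonempty (KummerTimesFrobenioid.{u, v, w} X) ↔
      ∃ M : CoveringMonoid.{u, w} G, Nonempty (KummerTimes X M) :=
  ⟨fun ⟨F⟩ => ⟨F.monoid, ⟨F.kummer⟩⟩, fun ⟨M, ⟨κ⟩⟩ => ⟨⟨M, κ⟩⟩⟩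

/-- **IUTchII:Def4.9(i)** (kurims p.155) A `×μ`-Kummer Frobenioid over `X` exists iff some covering
monoid carries a `×μ`-Kummer structure relative to `X`. [cite: Mochizuki2012, Def 4.9 (i) p.155] -/
theorem KummerTimesMuFrobenioid.nonempty_iff (X : GroupTheoreticUnits.{u, v} G) :
    Nonempty (KummerTimesMuFrobenioid.{u, v, w} X) ↔
      ∃ M : CoveringMonoid.{u, w} G, Nonempty (KummerTimesMu X M) :=
  ⟨fun ⟨F⟩ => ⟨F.monoid, ⟨F.kummer⟩⟩, fun ⟨M, ⟨κ⟩⟩ => ⟨⟨M, κ⟩⟩⟩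

/-- **IUTchII:Def4.9(i)** (kurims p.155) A split-`×`-Kummer Frobenioid is in particular a `×`-Kummer
Frobenioid (forget the splitting). [cite: Mochizuki2012, Def 4.9 (i) p.155] -/
theorem KummerTimesFrobenioid.nonempty_of_split {X : GroupTheoreticUnits.{u, v} G}
    (F : SplitKummerTimesFrobenioid.{u, v, w} X) : Nonempty (KummerTimesFrobenioid.{u, v, w} X) :=
  ⟨⟨F.monoid.toCoveringMonoid, F.kummer⟩⟩

/-- **IUTchII:Def4.9(i)** (kurims p.155) A split-`×μ`-Kummer Frobenioid is in particular a `×μ`-Kummer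
Frobenioid. [cite: Mochizuki2012, Def 4.9 (i) p.155] -/
theorem KummerTimesMuFrobenioid.nonempty_of_split {X : GroupTheoreticUnits.{u, v} G}
    (F : SplitKummerTimesMuFrobenioid.{u, v, w} X) : Nonempty (KummerTimesMuFrobenioid.{u, v, w} X) :=
  ⟨⟨F.monoid.toCoveringMonoid, F.kummer⟩⟩

/-- **IUTchII:Def4.9(iii)** (kurims p.156) The local datum `‡F^{⊢▶×μ}_w` at a nonarchimedean place
(abc-iut-L6-t2's `NonarchTriMuDatum`) yields the `×`-Kummer Frobenioid `‡F^⊢_w` ("by abuse of notation",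
via the producer `NonarchTriMuDatum.splitKummerTimes`). [cite: Mochizuki2012, Def 4.9 (iii) p.156] -/
theorem KummerTimesFrobenioid.nonempty_of_nonarchTriMuDatum {X : GroupTheoreticUnits.{u, v} G}
    {l : ℕ} {k : PlaceKind} (D : NonarchTriMuDatum.{u, w, v} l k G X) :
    Nonempty (KummerTimesFrobenioid.{u, v, w} X) :=
  KummerTimesFrobenioid.nonempty_of_split D.splitKummerTimes

/-- **IUTchII:Def4.9(iii)** (kurims p.155) … and the `×μ`-Kummer Frobenioid underlying `‡F^{⊢▶×μ}_w`
(via `NonarchTriMuDatum.splitKummerTimesMu`). [cite: Mochizuki2012, Def 4.9 (iii) p.155] -/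
theorem KummerTimesMuFrobenioid.nonempty_of_nonarchTriMuDatum {X : GroupTheoreticUnits.{u, v} G}
    {l : ℕ} {k : PlaceKind} (D : NonarchTriMuDatum.{u, w, v} l k G X) :
    Nonempty (KummerTimesMuFrobenioid.{u, v, w} X) :=
  KummerTimesMuFrobenioid.nonempty_of_split D.splitKummerTimesMu

/-! ### 3. The standard split model `O^▷(A) := O^×(G) × ϖ^ℕ` — every `X` is served -/

/-- **IUTchII:Def4.9(i)** (kurims p.155) NON-VACUITY AT EVERY PARAMETER, standard split model: for every
group `G` and every group-theoretic-units datum `X = (G ↷ O^×(G), Im(Ẑ^×))`, the monoid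
`O^▷(A) := O^×(G) × ϖ^ℕ` (`ϖ^ℕ` = `Multiplicative ℕ`; the shape of `O^▷_{k_v} = O^×_{k_v} × ϖ_v^ℕ`), with
`G` acting through `X` on the first factor and trivially on `ϖ`, has unit group `O^×(G)`; the
tautological identification `κ : O^×(G) ⥲ (O^×(G) × ϖ^ℕ)^×` is `G`-equivariant, so its `Im(Ẑ^×)`-orbit is
a `×`-Kummer structure and `G ↷ O^▷(A)` a `×`-Kummer Frobenioid. (Model: genuine in shape, valid at every
`X`; the identification `κ` is tautological — the anabelian content of `κ^×`, Remark 1.11.1 (b), is the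
named statement `KummerTimesUnique`, not modelled here.) [cite: Mochizuki2012, Def 4.9 (i) p.155] -/
theorem KummerTimesFrobenioid.nonempty_model (X : GroupTheoreticUnits.{u, v} G) :
    Nonempty (KummerTimesFrobenioid.{u, v, v} X) := by
  -- the `G`-action on `O^×(G) × ϖ^ℕ`
  let act : G →* MulAut (X.OxG × Multiplicative ℕ) :=
    MonoidHom.mk' (fun g => MulEquiv.prodCongr (X.act g) (MulEquiv.refl _)) fun g h =>
      MulEquiv.ext fun _ => by rw [map_mul]; rfl
  let M : CoveringMonoid.{u, v} G := ⟨X.OxG × Multiplicative ℕ, act⟩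
  -- the tautological identification of `O^×(G)` with the units of `O^×(G) × ϖ^ℕ`
  let e : X.OxG ≃* (X.OxG × Multiplicative ℕ)ˣ :=
    { toFun := fun u => ⟨(u, 1), (u⁻¹, 1), by simp, by simp⟩
      invFun := fun w => (w : X.OxG × Multiplicative ℕ).1
      left_inv := fun _ => rfl
      right_inv := fun w => by
        have h2 : (w : X.OxG × Multiplicative ℕ).2 = 1 := by
          have h := congrArg (fun p : X.OxG × Multiplicative ℕ => Multiplicative.toAdd p.2) w.val_inv
          simp only [Prod.snd_mul, Prod.snd_one, toAdd_mul, toAdd_one] at h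
          exact toAdd_eq_zero.mp (Nat.eq_zero_of_add_eq_zero_right h)
        ext
        · rfl
        · exact h2.symm
      map_mul' := fun u u' => Units.ext (Prod.ext rfl (mul_one _).symm) }
  have he : ∀ (g : G) (u : X.OxG), e (X.act g u) = M.unitsAct g (e u) := fun g u =>
    Units.ext (Prod.ext rfl rfl)
  exact KummerTimesFrobenioid.nonempty_of_equivariantIso X M ⟨e, he⟩

/-- **IUTchII:Def4.9(i)** (kurims p.155) The same standard split model `O^▷(A) := O^×(G) × ϖ^ℕ` is a
`×μ`-Kummer Frobenioid over every `X` (the `Ism`-orbit of the isomorphism induced on the quotients by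
torsion). [cite: Mochizuki2012, Def 4.9 (i) p.155] -/
theorem KummerTimesMuFrobenioid.nonempty_model (X : GroupTheoreticUnits.{u, v} G) :
    Nonempty (KummerTimesMuFrobenioid.{u, v, v} X) := by
  let act : G →* MulAut (X.OxG × Multiplicative ℕ) :=
    MonoidHom.mk' (fun g => MulEquiv.prodCongr (X.act g) (MulEquiv.refl _)) fun g h =>
      MulEquiv.ext fun _ => by rw [map_mul]; rfl
  let M : CoveringMonoid.{u, v} G := ⟨X.OxG × Multiplicative ℕ, act⟩
  let e : X.OxG ≃* (X.OxG × Multiplicative ℕ)ˣ :=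
    { toFun := fun u => ⟨(u, 1), (u⁻¹, 1), by simp, by simp⟩
      invFun := fun w => (w : X.OxG × Multiplicative ℕ).1
      left_inv := fun _ => rfl
      right_inv := fun w => by
        have h2 : (w : X.OxG × Multiplicative ℕ).2 = 1 := by
          have h := congrArg (fun p : X.OxG × Multiplicative ℕ => Multiplicative.toAdd p.2) w.val_inv
          simp only [Prod.snd_mul, Prod.snd_one, toAdd_mul, toAdd_one] at h
          exact toAdd_eq_zero.mp (Nat.eq_zero_of_add_eq_zero_right h)
        ext
        · rfl
        · exact h2.symm
      map_mul' := fun u u' => Units.ext (Prod.ext rfl (mul_one _).symm) }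
  have he : ∀ (g : G) (u : X.OxG), e (X.act g u) = M.unitsAct g (e u) := fun g u =>
    Units.ext (Prod.ext rfl rfl)
  exact KummerTimesMuFrobenioid.nonempty_of_equivariantIso X M ⟨e, he⟩

/-! ### 4. The discrete-valuation-ring model `O^▷ := R ∖ {0}` (abc-iut-L6-d7's datum, by name) -/

section DVR

variable {R : Type v} [CommRing R] [IsDomain R] [IsDiscreteValuationRing R]

/-- **IUTchII:Def4.9(iii)** (kurims p.156) GENUINE MONOID MODEL: for every discrete valuation ring `R`
(e.g. `𝒪_{K_v}`) and every group `G`, the split monoid `O^▷ := R ∖ {0}` of abc-iut-L6-d7's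
`nonempty_nonarchTriMuDatum'` (trivial `G`-action, tautological group-theoretic units) is a
`×`-Kummer Frobenioid over some `X` — the `‡F^⊢_w` of Def 4.9 (iii) at that model.
[cite: Mochizuki2012, Def 4.9 (iii) p.156] -/
theorem KummerTimesFrobenioid.nonempty_model_dvr (G : Type u) [Group G] :
    ∃ X : GroupTheoreticUnits.{u, v} G, ∃ F : KummerTimesFrobenioid.{u, v, v} X,
      (F.monoid.O : Type v) = R⁰ := by
  obtain ⟨X, D, hD⟩ := nonempty_nonarchTriMuDatum' (R := R) G 0 PlaceKind.goodNonarch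
  exact ⟨X, ⟨D.covering, D.kummerTimes⟩, hD⟩

/-- **IUTchII:Def4.9(iii)** (kurims p.155) … and a `×μ`-Kummer Frobenioid over the same kind of `X`
(the `‡F^{⊢▶×μ}_w` of Def 4.9 (iii) at that model, splitting forgotten).
[cite: Mochizuki2012, Def 4.9 (iii) p.155] -/
theorem KummerTimesMuFrobenioid.nonempty_model_dvr (G : Type u) [Group G] :
    ∃ X : GroupTheoreticUnits.{u, v} G, ∃ F : KummerTimesMuFrobenioid.{u, v, v} X,
      (F.monoid.O : Type v) = R⁰ := by
  obtain ⟨X, D, hD⟩ := nonempty_nonarchTriMuDatum' (R := R) G 0 PlaceKind.goodNonarch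
  exact ⟨X, ⟨D.covering, D.kummerTimesMu⟩, hD⟩

end DVR

end Literature.IUT.HodgeArakelov
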